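import Summits.CriticalPhenomena.CardyFormulaZ2.Theorems.CardyIKTransportIKMixedBoxCrossingTransportStubLinkHonCount

/-!
# Stub `stub_linkArcsIff` (H1 of the link decomposition), AUXILIARY FILE 1 — necklace bookkeeping
# (line `defect-closure-exploration`, reshape v5b, crux `IKMixedBoxCrossing`, stmt-CriticalPhenomena-5911)

Support file (`--supports stmt-CriticalPhenomena-5911`).  Vocabulary: `…TransportLinkDefs` §1 (necklaces `Necklace L`:
`k` blocks, block `i` = a black run of `runLen i` cells from offset `runStart i` followed by a white gap of `gapLen i`
cells from offset `gapStart i`; `row o = base + o`, `InRun`, `InGap`, `col`, `cross`); the block-order lemmas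
`blockEnd_le_runStart`, `blockEnd_le`, `row_inj` of `…TransportStubLinkHonCount` are reused.

Elementary arithmetic of the block layout, used by both directions of `LinkArcsIff`:
* `runStart_zero`, `runStart_succ`, `gapEnd_eq_of_last` (the blocks tile `[0, L)` in order), hence `block_unique`,
  `eq_of_inRun_inRun`, `not_inRun_inGap` (an offset lies in at most one run or gap) and `two_le : 2 ≤ L`;
* rows: `row_succ`, `exists_row`, `row_succ_ne`, and `row_gapEnd` (the row after the gap of block `i` is the first row
  of the cyclically next run `j`, `j.val = (i.val + 1) % k` — wrapping around through `(L : ZMod L) = 0`);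
* the presented column: `col_row_of_inRun`, `exists_inRun_of_col`, `cross_eq_true_iff`;
* THE FOUR STEP LEMMAS `inRun_step_up`, `inGap_step_up`, `inGap_step_down`, `inRun_step_down`: one row up or down from an
  offset of a run / a gap one stays in the same part of the block or lands exactly on the boundary cell of the
  neighbouring part (the registered statement `stub_linkArcsIff_runStepDown` is the last one, the only step that wraps).
-/

noncomputable section

namespace Summit.CriticalPhenomena.CardyFormulaZ2.Cruxes.IKMixedBoxCrossing.DefectClosureExploration

open scoped Classical
open LinkHonCountStub (blockEnd_le_runStart blockEnd_le row_inj)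

namespace LinkArcsIffStub

variable {L : ℕ} (N : Necklace L)

/-! ## Block layout -/

/-- The first run starts at offset `0`. -/
theorem runStart_zero : N.runStart ⟨0, N.hk⟩ = 0 := by
  unfold Necklace.runStart
  refine Finset.sum_eq_zero fun j hj => ?_
  simp only [Finset.mem_filter, Finset.mem_univ, true_and, Fin.lt_def] at hj
  omega

/-- The next run starts right after the current block. -/
theorem runStart_succ (i : Fin N.k) (h : i.val + 1 < N.k) :
    N.runStart ⟨i.val + 1, h⟩ = N.gapStart i + N.gapLen i := by
  unfold Necklace.gapStart Necklace.runStart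
  have hs : Finset.univ.filter (fun j : Fin N.k => j < ⟨i.val + 1, h⟩) =
      insert i (Finset.univ.filter (fun j : Fin N.k => j < i)) := by
    ext j
    simp only [Finset.mem_filter, Finset.mem_univ, true_and, Finset.mem_insert, Fin.lt_def, Fin.ext_iff]
    omega
  rw [hs, Finset.sum_insert (by simp)]
  ring

/-- The last block ends exactly at `L`. -/
theorem gapEnd_eq_of_last (i : Fin N.k) (h : i.val + 1 = N.k) : N.gapStart i + N.gapLen i = L := by
  have hs : insert i (Finset.univ.filter (fun l : Fin N.k => l < i)) = Finset.univ := by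
    ext l
    have hl := l.isLt
    simp only [Finset.mem_filter, Finset.mem_univ, true_and, Finset.mem_insert, Fin.lt_def, Fin.ext_iff, iff_true]
    omega
  have := N.total
  rw [← hs, Finset.sum_insert (by simp)] at this
  unfold Necklace.gapStart Necklace.runStart
  omega

/-- `2 ≤ L` (one block already has two cells). -/
theorem two_le (N : Necklace L) : 2 ≤ L := by
  have h1 := blockEnd_le N ⟨0, N.hk⟩
  have h2 := N.run_pos ⟨0, N.hk⟩
  have h3 := N.gap_pos ⟨0, N.hk⟩
  unfold Necklace.gapStart at h1
  omega

/-- An offset lies in at most one block. -/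
theorem block_unique {i j : Fin N.k} {o : ℕ} (hi : N.runStart i ≤ o ∧ o < N.gapStart i + N.gapLen i)
    (hj : N.runStart j ≤ o ∧ o < N.gapStart j + N.gapLen j) : i = j := by
  rcases lt_trichotomy i j with h | h | h
  · have := blockEnd_le_runStart N h
    omega
  · exact h
  · have := blockEnd_le_runStart N h
    omega

/-- Run offsets are below `L`. -/
theorem inRun_lt {i : Fin N.k} {o : ℕ} (h : N.InRun i o) : o < L := by
  have := blockEnd_le N i
  unfold Necklace.InRun at h
  omega

/-- Gap offsets are below `L`. -/
theorem inGap_lt {i : Fin N.k} {o : ℕ} (h : N.InGap i o) : o < L := by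
  have := blockEnd_le N i
  unfold Necklace.InGap at h
  omega

/-- Runs are disjoint. -/
theorem eq_of_inRun_inRun {i j : Fin N.k} {o : ℕ} (hi : N.InRun i o) (hj : N.InRun j o) : i = j := by
  unfold Necklace.InRun at hi hj
  exact block_unique N ⟨hi.1, by omega⟩ ⟨hj.1, by omega⟩

/-- Runs and gaps are disjoint. -/
theorem not_inRun_inGap {i j : Fin N.k} {o : ℕ} (hi : N.InRun i o) (hj : N.InGap j o) : False := by
  have hj' : N.runStart j ≤ o ∧ o < N.gapStart j + N.gapLen j := by
    unfold Necklace.InGap Necklace.gapStart at hj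
    unfold Necklace.gapStart
    omega
  have hi' : N.runStart i ≤ o ∧ o < N.gapStart i + N.gapLen i := by
    unfold Necklace.InRun at hi
    omega
  have hij : i = j := block_unique N hi' hj'
  subst hij
  unfold Necklace.InRun at hi
  unfold Necklace.InGap at hj
  omega

/-- The first cell of a run lies in the run. -/
theorem inRun_runStart (i : Fin N.k) : N.InRun i (N.runStart i) := by
  unfold Necklace.InRun Necklace.gapStart
  have := N.run_pos i
  omega

/-- The last cell of a run lies in the run. -/
theorem inRun_gapStart_sub_one (i : Fin N.k) : N.InRun i (N.gapStart i - 1) := by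
  unfold Necklace.InRun Necklace.gapStart
  have := N.run_pos i
  omega

/-! ## Rows -/

/-- Rows one offset apart differ by `1`. -/
theorem row_succ (o : ℕ) : N.row (o + 1) = N.row o + 1 := by
  unfold Necklace.row
  push_cast
  ring

/-- Every row is the row of an offset below `L`. -/
theorem exists_row [NeZero L] (r : ZMod L) : ∃ o, o < L ∧ N.row o = r :=
  ⟨(r - N.base).val, ZMod.val_lt _, by unfold Necklace.row; rw [ZMod.natCast_zmod_val]; abel⟩

/-- Consecutive rows are distinct (`2 ≤ L`). -/
theorem row_succ_ne (o : ℕ) : N.row (o + 1) ≠ N.row o := by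
  intro h
  rw [row_succ] at h
  have h1 : ((1 : ℕ) : ZMod L) = ((0 : ℕ) : ZMod L) := by
    rw [Nat.cast_one, Nat.cast_zero]
    simpa using h
  rw [ZMod.natCast_eq_natCast_iff', Nat.zero_mod, Nat.mod_eq_of_lt (two_le N)] at h1
  exact one_ne_zero h1

/-- The row after the gap of block `i` is the first row of the cyclically next run (wrapping around the cycle). -/
theorem row_gapEnd (i j : Fin N.k) (hj : j.val = (i.val + 1) % N.k) :
    N.row (N.gapStart i + N.gapLen i) = N.row (N.runStart j) := by
  by_cases h : i.val + 1 < N.k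
  · have hn : j = ⟨i.val + 1, h⟩ := Fin.ext (by rw [hj, Nat.mod_eq_of_lt h])
    rw [hn, runStart_succ N i h]
  · have hk : i.val + 1 = N.k := by have := i.isLt; omega
    have hn : j = ⟨0, N.hk⟩ := Fin.ext (by rw [hj, hk, Nat.mod_self])
    rw [hn, runStart_zero, gapEnd_eq_of_last N i hk]
    unfold Necklace.row
    rw [ZMod.natCast_self, Nat.cast_zero]

/-! ## The presented column and the crossing condition -/

/-- The run rows are black in the presented column. -/
theorem col_row_of_inRun {i : Fin N.k} {o : ℕ} (h : N.InRun i o) : N.col (N.row o) = true :=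
  decide_eq_true ⟨i, o, inRun_lt N h, h, rfl⟩

/-- A black row of the presented column is a run row. -/
theorem exists_inRun_of_col {r : ZMod L} (h : N.col r = true) :
    ∃ i : Fin N.k, ∃ o : ℕ, o < L ∧ N.InRun i o ∧ N.row o = r := by
  unfold Necklace.col at h
  exact of_decide_eq_true h

/-- The crossing condition, unfolded. -/
theorem cross_eq_true_iff (c f : ZMod L → Bool) (i : Fin N.k) :
    N.cross c f i = true ↔ (∀ o, N.InGap i o → c (N.row o) = true) ∧
      (c (N.row (N.gapStart i - 1)) = true ∨ f (N.row (N.gapStart i - 1)) = false) ∧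
      (c (N.row (N.gapStart i + N.gapLen i)) = true ∨ f (N.row (N.gapStart i + N.gapLen i - 1)) = true) := by
  unfold Necklace.cross
  exact decide_eq_true_iff

/-- A run cell of the last interior column, from a run offset. -/
theorem mk_mem_runCells {w : ℕ} {i : Fin N.k} {o : ℕ} (h : N.InRun i o) :
    ((Fin.last w, N.row o) : Fin (w + 1) × ZMod L) ∈ N.runCells i :=
  ⟨rfl, o, inRun_lt N h, h, rfl⟩

/-! ## The four step lemmas -/

/-- STEP UP FROM A RUN: the next offset is in the same run or is the first gap offset (no wrap-around). -/
theorem inRun_step_up {i : Fin N.k} {o : ℕ} (h : N.InRun i o) :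
    o + 1 < L ∧ (N.InRun i (o + 1) ∨ (o + 1 = N.gapStart i ∧ N.InGap i (o + 1))) := by
  have := blockEnd_le N i
  have := N.gap_pos i
  unfold Necklace.InRun Necklace.InGap at *
  omega

/-- STEP UP FROM A GAP: the next offset is in the same gap, or the gap ends and the next row is the first row of the
cyclically next run. -/
theorem inGap_step_up {i : Fin N.k} {o : ℕ} (h : N.InGap i o) :
    (o + 1 < L ∧ N.InGap i (o + 1)) ∨ (o + 1 = N.gapStart i + N.gapLen i ∧
      ∃ j : Fin N.k, j.val = (i.val + 1) % N.k ∧ N.row (o + 1) = N.row (N.runStart j)) := by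
  have := blockEnd_le N i
  by_cases h1 : o + 1 < N.gapStart i + N.gapLen i
  · left
    unfold Necklace.InGap at *
    omega
  · right
    have he : o + 1 = N.gapStart i + N.gapLen i := by unfold Necklace.InGap at h; omega
    refine ⟨he, ⟨(i.val + 1) % N.k, Nat.mod_lt _ N.hk⟩, rfl, ?_⟩
    rw [he, row_gapEnd N i ⟨(i.val + 1) % N.k, Nat.mod_lt _ N.hk⟩ rfl]

/-- STEP DOWN FROM A GAP: the previous offset is in the same gap, or it is the last cell of the run of the block. -/
theorem inGap_step_down {i : Fin N.k} {o : ℕ} (h : N.InGap i o) :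
    ∃ o', o' + 1 = o ∧ (N.InGap i o' ∨ (o = N.gapStart i ∧ N.InRun i o')) := by
  have := N.run_pos i
  unfold Necklace.InGap Necklace.InRun Necklace.gapStart at *
  exact ⟨o - 1, by omega, by omega⟩

/-- STEP DOWN FROM A RUN: the previous row is in the same run, or it is the last gap cell of the cyclically previous
block. -/
theorem inRun_step_down {i : Fin N.k} {o : ℕ} (h : N.InRun i o) :
    ∃ o', o' < L ∧ N.row o' + 1 = N.row o ∧ (N.InRun i o' ∨
      (∃ j : Fin N.k, i.val = (j.val + 1) % N.k ∧ N.InGap j o' ∧ o' + 1 = N.gapStart j + N.gapLen j)) := by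
  have hoL := inRun_lt N h
  by_cases h1 : N.runStart i < o
  · refine ⟨o - 1, by omega, ?_, Or.inl ?_⟩
    · rw [← row_succ, Nat.sub_add_cancel (by omega)]
    · unfold Necklace.InRun at *
      omega
  · have ho : o = N.runStart i := by unfold Necklace.InRun at h; omega
    by_cases hi : i.val = 0
    · -- wrap around: the previous row is the last row `L - 1`, in the gap of the last block
      have hi0 : i = ⟨0, N.hk⟩ := Fin.ext hi
      have hk1 : N.k - 1 + 1 = N.k := Nat.sub_add_cancel N.hk
      set j : Fin N.k := ⟨N.k - 1, by omega⟩ with hj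
      have hje := gapEnd_eq_of_last N j hk1
      have hL := two_le N
      refine ⟨L - 1, by omega, ?_, Or.inr ⟨j, ?_, ?_, ?_⟩⟩
      · rw [← row_succ, Nat.sub_add_cancel (by omega), ho, hi0, runStart_zero]
        unfold Necklace.row
        rw [ZMod.natCast_self, Nat.cast_zero]
      · rw [hi]
        show 0 = (N.k - 1 + 1) % N.k
        rw [hk1, Nat.mod_self]
      · have := N.gap_pos j
        unfold Necklace.InGap
        omega
      · omega
    · set j : Fin N.k := ⟨i.val - 1, by omega⟩ with hj
      have hji : (⟨j.val + 1, by simp [hj]; omega⟩ : Fin N.k) = i := Fin.ext (by simp [hj]; omega)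
      have hrs := runStart_succ N j (by simp [hj]; omega)
      rw [hji] at hrs
      have := N.gap_pos j
      refine ⟨o - 1, by omega, ?_, Or.inr ⟨j, ?_, ?_, ?_⟩⟩
      · rw [← row_succ, Nat.sub_add_cancel (by omega)]
      · rw [Nat.mod_eq_of_lt (by simp [hj]; omega)]
        simp [hj]
        omega
      · unfold Necklace.InGap
        omega
      · omega

end LinkArcsIffStub

/-- **`stub_linkArcsIff`, bookkeeping** (auxiliary registered statement): one row below a run cell of a necklace lies
a cell of the same run, or the last gap cell of the cyclically previous block. -/
theorem stub_linkArcsIff_runStepDown : ∀ (L : ℕ) (N : Necklace L) (i : Fin N.k) (o : ℕ), N.InRun i o →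
    ∃ o', o' < L ∧ N.row o' + 1 = N.row o ∧
      (N.InRun i o' ∨ ∃ j : Fin N.k, (j.val + 1) % N.k = i.val ∧ N.InGap j o' ∧ o' + 1 = N.gapStart j + N.gapLen j) :=
  fun _ N _ _ h => by
    obtain ⟨o', h1, h2, h3⟩ := LinkArcsIffStub.inRun_step_down N h
    refine ⟨o', h1, h2, h3.imp id ?_⟩
    rintro ⟨j, hj, h4, h5⟩
    exact ⟨j, hj.symm, h4, h5⟩

end Summit.CriticalPhenomena.CardyFormulaZ2.Cruxes.IKMixedBoxCrossing.DefectClosureExploration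

end
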